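import Summits.ResolutionOfSingularities.ResolutionOfSingularities.Theorems.FrobeniusLadderFInjectiveMacaulayficationCINotFullAtMaximalIdeal
import Summits.ResolutionOfSingularities.ResolutionOfSingularities.Theorems.FrobeniusLadderFInjectiveMacaulayficationDoublePointFedderOdd
import Mathlib.RingTheory.MvPolynomial.WeightedHomogeneous
import Mathlib.RingTheory.MvPolynomial.Ideal
import HarnessLib

/-!
# (A5d) BED CI-1 — THE INPUT COLUMN: the vertex of the diagonal Brieskorn–Pham complete-intersection pair
# `X = V(x₀²+x₁³+x₂³+x₃⁴+x₄⁵+x₅⁵, x₀²+2x₁³+3x₂³+4x₃⁴+5x₄⁵+6x₅⁵) ⊂ 𝔸⁶` is NOT FULL — FOR EVERY PRIME `p` AND EVERY FIELD `k` (p-UNIFORM)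
# (crux `FInjectiveMacaulayfication` stmt-ResolutionOfSingularities-15315, chain w45a; res-L1-w45a-plan-1 RULINGS R23.10 (A5d) / R23.11 (1): «the INPUT NOT-FULL WITNESS at the
# vertex — `diagonalBPCI_vertex_not_full : ¬ FullCl p (stalk v)` via the CI-Fedder criterion: (F₁F₂)^{p−1} ∈ 𝔪^{[p]}, which is p-UNIFORM here … so state it for EVERY
# prime p»; seat res-L1-w45a-stub-2 g13)

[OURS · L1 W4.5a] Support file (`--supports stmt-ResolutionOfSingularities-15315 --as helper`); def-free; UNCONDITIONAL; no named fact, no sorry; NOT a statement of any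
manuscript; replaces the role of NO printed item. Nothing of the crux is proved. AI-written (AI review weaker than expert review).

* §1 (generic, any `n`) `mem_span_X_pow_of_isWeightedHomogeneous` — A WEIGHTED PIGEONHOLE: a polynomial weighted-homogeneous of weight `D > (p−1)·Σᵢ wᵢ` lies in
  `(y₀^p, …, y_{n−1}^p)` (a monomial outside has all exponents `≤ p−1`, hence weight `≤ (p−1)·Σ wᵢ`); `monomial_mem_of_le` — a monic monomial with `yᵢ`-exponent `≥ e` lies in
  any ideal containing `yᵢ^e`.
* §2 (the bed) `isWeightedHomogeneous_F0/F1` — `F₁, F₂` are weighted-homogeneous of weight `60` for `w = (30, 20, 20, 15, 12, 12)`; ★ `prod_pow_mem_span_X_pow` — THE p-UNIFORM CI FEDDER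
  CERTIFICATE `(F₁F₂)^{p−1} ∈ (x₀^p, …, x₅^p)` for EVERY `p ≥ 2` (weight `120(p−1) > 109(p−1)`); `constantCoeff_F`; ★ `sop_certificate` — `(x₀, …, x₅)⁴ ⊆ (F₁, F₂, x₂, x₃, x₄, x₅)`
  (`x₁³ = F₂ − F₁ − 2x₂³ − 3x₃⁴ − 4x₄⁵ − 5x₅⁵`, `x₀² = F₁ − x₁³ − …`, so every degree-4 monomial is in), i.e. `(F₁, F₂, x₂, …, x₅)` is a system of parameters of `k[x]_{(x)}` and
  `V(F₁, F₂)` has the expected dimension `4` at the vertex — with NO hypothesis on `p` (the coefficient `2 − 1 = 1` of `x₁³` in `F₂ − F₁` is a unit in every characteristic).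
* §3 ★★ `diagonalBPCI_vertex_not_full` — for EVERY prime `p` and EVERY field `k` of characteristic `p`: `¬ FullCl p (𝒪_{X,v})` at the vertex `v` — ONE application of
  ✓ `CINotFullAtMaximalIdeal.ci_not_fullCl_stalk_origin` (the CI Fedder NECESSITY engine ✓ `CIFedderNecessity`). This is the INPUT column of census ROW #11 / BED CI-1 (cured side
  ✓ `DiagonalBPCIRow.diagonalBPCI_pointFloorCured`, `p ≥ 7`); primality of `(F₁, F₂)` is NOT needed on this side.

[cite: Fedder1983, Prop. 1.7, Thm. 1.12 and Prop. 2.1]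
-/

-- single-problem summit: the doubled namespace component is forced
set_option linter.dupNamespace false

noncomputable section

open AlgebraicGeometry MvPolynomial IsLocalRing

namespace Summit.ResolutionOfSingularities.ResolutionOfSingularities.Theorems.FInjectiveMacaulayfication.DiagonalBPCIVertexNotFull

open Summit.ResolutionOfSingularities.ResolutionOfSingularities.Theorems.FInjectiveMacaulayfication SliceableCentre

variable (k : Type) [Field k]

/-! ## §1 A weighted pigeonhole into `(y₀^p, …, y_{n−1}^p)`, and monomial membership -/

/-- **WEIGHTED PIGEONHOLE.** If `φ ∈ k[y₀, …, y_{n−1}]` is weighted-homogeneous of weight `D` for natural weights `w` with `(p−1)·Σᵢ wᵢ < D`, then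
`φ ∈ (y₀^p, …, y_{n−1}^p)`: a monomial of the support with all exponents `≤ p − 1` would have weight `≤ (p−1)·Σ wᵢ < D`. [folklore] -/
theorem mem_span_X_pow_of_isWeightedHomogeneous {n : ℕ} (p : ℕ) (w : Fin n → ℕ) (φ : MvPolynomial (Fin n) k) (D : ℕ)
    (hφ : IsWeightedHomogeneous w φ D) (hD : (p - 1) * ∑ i, w i < D) :
    φ ∈ Ideal.span (Set.range fun i : Fin n => (X i : MvPolynomial (Fin n) k) ^ p) := by
  rw [DoublePointFedder.mem_span_X_pow_iff]
  intro m hm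
  by_contra hcon
  simp only [not_exists, not_le] at hcon
  have hw : Finsupp.weight w m = D := hφ (mem_support_iff.mp hm)
  have hle : Finsupp.weight w m ≤ (p - 1) * ∑ i, w i := by
    rw [Finsupp.weight_apply, Finsupp.sum_fintype _ _ (fun i => by simp), Finset.mul_sum]
    exact Finset.sum_le_sum fun i _ => by
      rw [smul_eq_mul]
      exact Nat.mul_le_mul_right _ (by have := hcon i; omega)
  omega

/-- `yᵢ^a` is weighted-homogeneous of weight `a·wᵢ`. [folklore] -/
theorem isWeightedHomogeneous_X_pow {n : ℕ} (w : Fin n → ℕ) (i : Fin n) (a D : ℕ) (h : a * w i = D) :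
    IsWeightedHomogeneous w ((X i : MvPolynomial (Fin n) k) ^ a) D := by
  have hX := (isWeightedHomogeneous_X k w i).pow a
  rwa [smul_eq_mul, h] at hX

/-- A monic monomial whose `yᵢ`-exponent is at least `e` lies in every ideal containing `yᵢ^e`. [folklore] -/
theorem monomial_mem_of_le {n : ℕ} {J : Ideal (MvPolynomial (Fin n) k)} (i : Fin n) (e : ℕ) (m : Fin n →₀ ℕ) (h : e ≤ m i)
    (hX : (X i : MvPolynomial (Fin n) k) ^ e ∈ J) : monomial m (1 : k) ∈ J := by
  have hm : m = Finsupp.single i e + (m - Finsupp.single i e) :=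
    (add_tsub_cancel_of_le (Finsupp.single_le_iff.mpr h)).symm
  rw [hm, monomial_single_add]
  exact J.mul_mem_right _ hX

/-! ## §2 The bed: weights, the p-uniform CI Fedder certificate, the s.o.p. certificate -/

section Bed

variable (F : Fin 2 → MvPolynomial (Fin 6) k)
  (hF0 : F 0 = X 0 ^ 2 + X 1 ^ 3 + X 2 ^ 3 + X 3 ^ 4 + X 4 ^ 5 + X 5 ^ 5)
  (hF1 : F 1 = X 0 ^ 2 + C 2 * X 1 ^ 3 + C 3 * X 2 ^ 3 + C 4 * X 3 ^ 4 + C 5 * X 4 ^ 5 + C 6 * X 5 ^ 5)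
include hF0 hF1

omit hF1 in
/-- `F₁ = x₀²+x₁³+x₂³+x₃⁴+x₄⁵+x₅⁵` is weighted-homogeneous of weight `60` for `w = (30, 20, 20, 15, 12, 12)`. [folklore] -/
theorem isWeightedHomogeneous_F0 : IsWeightedHomogeneous (![30, 20, 20, 15, 12, 12] : Fin 6 → ℕ) (F 0) 60 := by
  have hX : ∀ (i : Fin 6) (a : ℕ), a * (![30, 20, 20, 15, 12, 12] : Fin 6 → ℕ) i = 60 →
      IsWeightedHomogeneous (![30, 20, 20, 15, 12, 12] : Fin 6 → ℕ) ((X i : MvPolynomial (Fin 6) k) ^ a) 60 :=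
    fun i a h => isWeightedHomogeneous_X_pow k _ i a 60 h
  rw [hF0]
  exact (((((hX 0 2 (by decide)).add (hX 1 3 (by decide))).add (hX 2 3 (by decide))).add (hX 3 4 (by decide))).add
    (hX 4 5 (by decide))).add (hX 5 5 (by decide))

omit hF0 in
/-- `F₂ = x₀²+2x₁³+3x₂³+4x₃⁴+5x₄⁵+6x₅⁵` is weighted-homogeneous of weight `60` for `w = (30, 20, 20, 15, 12, 12)`. [folklore] -/
theorem isWeightedHomogeneous_F1 : IsWeightedHomogeneous (![30, 20, 20, 15, 12, 12] : Fin 6 → ℕ) (F 1) 60 := by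
  have hX : ∀ (i : Fin 6) (a : ℕ), a * (![30, 20, 20, 15, 12, 12] : Fin 6 → ℕ) i = 60 →
      IsWeightedHomogeneous (![30, 20, 20, 15, 12, 12] : Fin 6 → ℕ) ((X i : MvPolynomial (Fin 6) k) ^ a) 60 :=
    fun i a h => isWeightedHomogeneous_X_pow k _ i a 60 h
  rw [hF1]
  exact (((((hX 0 2 (by decide)).add ((hX 1 3 (by decide)).C_mul 2)).add ((hX 2 3 (by decide)).C_mul 3)).add
    ((hX 3 4 (by decide)).C_mul 4)).add ((hX 4 5 (by decide)).C_mul 5)).add ((hX 5 5 (by decide)).C_mul 6)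

/-- ★ **THE p-UNIFORM CI FEDDER CERTIFICATE OF THE VERTEX**: `(F₁·F₂)^{p−1} ∈ (x₀^p, …, x₅^p)` for EVERY `p ≥ 2` — `F₁F₂` is weighted-homogeneous of weight `120`
for `w = (30, 20, 20, 15, 12, 12)`, so `(F₁F₂)^{p−1}` has weight `120(p−1) > 109(p−1) = (p−1)·Σ wᵢ` (equivalently: `Σ 1/aᵢ = 109/60 < 2`). [OURS · certificate;
cite: Fedder1983, Prop. 2.1] -/
theorem prod_pow_mem_span_X_pow (p : ℕ) (hp : 2 ≤ p) :
    (F 0 * F 1) ^ (p - 1) ∈ Ideal.span (Set.range fun i : Fin 6 => (X i : MvPolynomial (Fin 6) k) ^ p) := by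
  have hw : IsWeightedHomogeneous (![30, 20, 20, 15, 12, 12] : Fin 6 → ℕ) ((F 0 * F 1) ^ (p - 1)) ((p - 1) • (60 + 60)) :=
    ((isWeightedHomogeneous_F0 k F hF0).mul (isWeightedHomogeneous_F1 k F hF1)).pow (p - 1)
  refine mem_span_X_pow_of_isWeightedHomogeneous k p _ _ _ hw ?_
  have hsum : ∑ i : Fin 6, (![30, 20, 20, 15, 12, 12] : Fin 6 → ℕ) i = 109 := by decide
  rw [hsum, smul_eq_mul]
  omega

/-- `F₁, F₂` vanish at the origin. [plumbing] -/
theorem constantCoeff_F : ∀ l : Fin 2, constantCoeff (F l) = 0 := by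
  refine Fin.forall_fin_two.mpr ⟨?_, ?_⟩
  · rw [hF0]; simp [constantCoeff_X]
  · rw [hF1]; simp [constantCoeff_X]

/-- ★ **THE S.O.P. CERTIFICATE**: `(x₀, …, x₅)⁴ ⊆ (F₁, F₂, x₂, x₃, x₄, x₅)` — since `x₁³ = F₂ − F₁ − 2x₂³ − 3x₃⁴ − 4x₄⁵ − 5x₅⁵` and `x₀² = F₁ − x₁³ − x₂³ − x₃⁴ − x₄⁵ − x₅⁵` lie in
the ideal, and every monomial of degree `4` is divisible by one of `x₂, x₃, x₄, x₅, x₀², x₁³`. No hypothesis on the characteristic. [OURS · certificate; folklore] -/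
theorem sop_certificate :
    Ideal.span (Set.range (X : Fin 6 → MvPolynomial (Fin 6) k)) ^ 4 ≤ Ideal.ofList (List.ofFn F ++ [X 2, X 3, X 4, X 5]) := by
  set J : Ideal (MvPolynomial (Fin 6) k) := Ideal.ofList (List.ofFn F ++ [X 2, X 3, X 4, X 5]) with hJ
  have hmem : ∀ x ∈ List.ofFn F ++ [X 2, X 3, X 4, X 5], x ∈ J := fun x hx => Ideal.subset_span hx
  have hF0J : F 0 ∈ J := hmem _ (List.mem_append.mpr (Or.inl ((List.mem_ofFn' _ _).mpr ⟨0, rfl⟩)))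
  have hF1J : F 1 ∈ J := hmem _ (List.mem_append.mpr (Or.inl ((List.mem_ofFn' _ _).mpr ⟨1, rfl⟩)))
  have hX2 : (X 2 : MvPolynomial (Fin 6) k) ∈ J := hmem _ (by simp)
  have hX3 : (X 3 : MvPolynomial (Fin 6) k) ∈ J := hmem _ (by simp)
  have hX4 : (X 4 : MvPolynomial (Fin 6) k) ∈ J := hmem _ (by simp)
  have hX5 : (X 5 : MvPolynomial (Fin 6) k) ∈ J := hmem _ (by simp)
  have hX1 : (X 1 : MvPolynomial (Fin 6) k) ^ 3 ∈ J := by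
    have e : (X 1 : MvPolynomial (Fin 6) k) ^ 3 =
        F 1 - F 0 - (2 * X 2 ^ 2) * X 2 - (3 * X 3 ^ 3) * X 3 - (4 * X 4 ^ 4) * X 4 - (5 * X 5 ^ 4) * X 5 := by
      rw [hF0, hF1]; simp only [map_ofNat]; ring
    rw [e]
    exact sub_mem (sub_mem (sub_mem (sub_mem (sub_mem hF1J hF0J) (J.mul_mem_left _ hX2)) (J.mul_mem_left _ hX3))
      (J.mul_mem_left _ hX4)) (J.mul_mem_left _ hX5)
  have hX0 : (X 0 : MvPolynomial (Fin 6) k) ^ 2 ∈ J := by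
    have e : (X 0 : MvPolynomial (Fin 6) k) ^ 2 = F 0 - X 1 ^ 3 - X 2 ^ 2 * X 2 - X 3 ^ 3 * X 3 - X 4 ^ 4 * X 4 - X 5 ^ 4 * X 5 := by
      rw [hF0]; ring
    rw [e]
    exact sub_mem (sub_mem (sub_mem (sub_mem (sub_mem hF0J hX1) (J.mul_mem_left _ hX2)) (J.mul_mem_left _ hX3))
      (J.mul_mem_left _ hX4)) (J.mul_mem_left _ hX5)
  -- every monomial of degree 4 lies in `J`
  rw [show Ideal.span (Set.range (X : Fin 6 → MvPolynomial (Fin 6) k)) = idealOfVars (Fin 6) k from rfl, pow_idealOfVars_eq_span,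
    Ideal.span_le]
  rintro _ ⟨m, hm, rfl⟩
  rw [Set.mem_preimage, Set.mem_singleton_iff, Finsupp.degree_eq_sum, Fin.sum_univ_six] at hm
  change monomial m (1 : k) ∈ J
  by_cases h2 : 1 ≤ m 2
  · exact monomial_mem_of_le k 2 1 m h2 (by rw [pow_one]; exact hX2)
  by_cases h3 : 1 ≤ m 3
  · exact monomial_mem_of_le k 3 1 m h3 (by rw [pow_one]; exact hX3)
  by_cases h4 : 1 ≤ m 4
  · exact monomial_mem_of_le k 4 1 m h4 (by rw [pow_one]; exact hX4)
  by_cases h5 : 1 ≤ m 5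
  · exact monomial_mem_of_le k 5 1 m h5 (by rw [pow_one]; exact hX5)
  by_cases h0 : 2 ≤ m 0
  · exact monomial_mem_of_le k 0 2 m h0 hX0
  · exact monomial_mem_of_le k 1 3 m (by omega) hX1

end Bed

/-! ## §3 ★★ The vertex of BED CI-1 is NOT FULL, for every prime -/

/-- ★★ **BED CI-1, INPUT COLUMN, p-UNIFORM: the vertex of `V(x₀²+x₁³+x₂³+x₃⁴+x₄⁵+x₅⁵, x₀²+2x₁³+3x₂³+4x₃⁴+5x₄⁵+6x₅⁵) ⊂ 𝔸⁶` is NOT a FULL point — for EVERY prime `p`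
and EVERY field `k` of characteristic `p`**: some system of parameters of `𝒪_{X,v}` generates an ideal that is not Frobenius closed (the CI Fedder criterion,
necessity: `(F₁F₂)^{p−1} ∈ 𝔪^{[p]}` by `prod_pow_mem_span_X_pow`, expected dimension by `sop_certificate`; ONE application of ✓ `CINotFullAtMaximalIdeal.ci_not_fullCl_stalk_origin`).
No hypothesis on `p`; primality of `(F₁, F₂)` not used. [OURS · census certificate (input side of ROW #11); cite: Fedder1983, Thm. 1.12 and Prop. 2.1] -/
theorem diagonalBPCI_vertex_not_full (p : ℕ) [Fact p.Prime] (k : Type) [Field k] [CharP k p]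
    (F : Fin 2 → MvPolynomial (Fin 6) k)
    (hF0 : F 0 = X 0 ^ 2 + X 1 ^ 3 + X 2 ^ 3 + X 3 ^ 4 + X 4 ^ 5 + X 5 ^ 5)
    (hF1 : F 1 = X 0 ^ 2 + C 2 * X 1 ^ 3 + C 3 * X 2 ^ 3 + C 4 * X 3 ^ 4 + C 5 * X 4 ^ 5 + C 6 * X 5 ^ 5)
    (v : Spec (.of (MvPolynomial (Fin 6) k ⧸ Ideal.span (Set.range F))))
    (hvm : v.asIdeal = Ideal.span (Set.range fun j : Fin 6 => Ideal.Quotient.mk (Ideal.span (Set.range F)) (X j))) :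
    ¬ FullCl p ((Spec (.of (MvPolynomial (Fin 6) k ⧸ Ideal.span (Set.range F)))).presheaf.stalk v) := by
  have hfed : (∏ l, F l) ^ (p - 1) ∈ Ideal.span (Set.range fun i : Fin 6 => (X i : MvPolynomial (Fin 6) k) ^ p) := by
    rw [Fin.prod_univ_two]
    exact prod_pow_mem_span_X_pow k F hF0 hF1 p (Fact.out : p.Prime).two_le
  exact CINotFullAtMaximalIdeal.ci_not_fullCl_stalk_origin p k F (constantCoeff_F k F hF0 hF1) hfed [X 2, X 3, X 4, X 5]
    (by simp [constantCoeff_X]) rfl 4 (sop_certificate k F hF0 hF1) v hvm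

end Summit.ResolutionOfSingularities.ResolutionOfSingularities.Theorems.FInjectiveMacaulayfication.DiagonalBPCIVertexNotFull

end
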